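import Literature.MathematicalPhysics.QuantumFieldTheory.Balaban1983to89.B3Cor23Concrete

/-!
# `Balaban1983to89.B3IGraph` — T. Bałaban, *(Higgs)₂,₃ quantum fields in a finite volume. III. Renormalization*,
Commun. Math. Phys. **88** (1983) 411–445 [Balaban1983Higgs3]: the graphs of the concrete model `B3Cor23Concrete` over an
ARBITRARY finite vertex type (carrier for graph surgeries such as the attachment of p. 423)

statement-level skeleton of published theorems with citation tags; proofs where landed; nothing here is a claim about the Yang–Mills mass gap

PDF held: `paper:balaban1983-higgs-2-3-quantum-fields-finite-volume` (journal page = PDF page + 410); renders read as images: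
`…/b2b-balaban-ref1/pages/1983-cmp88-higgs23-III/1983-cmp88-higgs23-III-p005, p012, p013-x2.png` (pp. 415, 422, 423).
CITATION HEADER (lean-in-tree rule).  lit-balaban TYPED SKELETON (HOME `run/shared/lean/pub/lit-balaban/`), Phase 2, seat p18
(gen 4), unit `lit-balaban-p18`: infrastructure for SKELETON row **B3.Eq2.2-2.3** (owner r15) — the p. 423 sentence *"Thus the
degree of G is the same as the degree of a graph G′ obtained from G by attaching the corresponding graphs to the mass
renormalization vertices"* needs graphs whose vertex set is ({vertices of G} ∖ {v}) ⊔ {vertices of G₀}; `B3Cor23Concrete.Graph`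
indexes vertices by `Fin nV`.  THIS MODULE: `IGraph nbar ι` = the same structure (p. 415: catalogue vertices, internal lines as
the fixed-point-free symmetric type-preserving pairing «other endpoint», at least one line) over any index type `ι`, with the
incidence counts (2.1) (`intScalar`, `intVector`, `intDiffs`), D_G(v) (`vertexDeg` = r15's `degreeIn` on `toCounts`) and D(G) of
(2.2) (`deg`); `toIGraph` views a `B3Cor23Concrete.Graph` as an `IGraph` over `Fin nV` with the same degree (`deg_toIGraph`).
Sorry-free; defs with bodies; no `Prop` fact.
-/

namespace Literature.MathematicalPhysics.QuantumFieldTheory.Balaban1983to89.B3IGraph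

open Finset B3Prop1 B3Sect2Statements B3VertexBridge B3Cor23Concrete

/-! ## Graphs of the model over an arbitrary finite vertex type -/

/-- The legs of a family of catalogue vertices indexed by `ι` (as `B3Cor23Concrete.Leg`, which is the case ι = Fin nV).
[cite: Balaban1983Higgs3, (1.17) p.415] -/
abbrev ILeg {ι : Type} (kind : ι → VertexKind) : Type :=
  Σ i : ι, (Fin (kind i).scalarLegs ⊕ Fin (kind i).vectorLegs)

/-- A graph of the perturbation expansion (p. 415: vertices of the catalogue, internal lines = the fixed-point-free symmetric
type-preserving pairing «other endpoint», at least one line) whose vertices are indexed by an arbitrary type `ι` — the target of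
the attachment surgery of p. 423. [cite: Balaban1983Higgs3, p.415] -/
structure IGraph (nbar : ℕ) (ι : Type) where
  /-- the vertices, from the catalogue (1.6)–(1.15) -/
  kind : ι → VertexKind
  /-- the printed side conditions -/
  adm : ∀ i, (kind i).Admissible nbar
  /-- the other endpoint of the line through a leg (`none` = external leg) -/
  other : ILeg kind → Option (ILeg kind)
  /-- a line has two distinct endpoints -/
  other_ne : ∀ x y, other x = some y → y ≠ x
  /-- "the other endpoint" is symmetric -/
  other_symm : ∀ x y, other x = some y → other y = some x
  /-- scalar lines join φ′-legs, vector lines join A′-legs -/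
  other_isLeft : ∀ x y, other x = some y → x.2.isLeft = y.2.isLeft
  /-- there is at least one internal line -/
  exists_line : ∃ x, (other x).isSome

namespace IGraph

variable {nbar : ℕ} {ι : Type} [Fintype ι] [DecidableEq ι] (Γ : IGraph nbar ι)

/-- internal φ′-legs of a vertex ((2.1) p. 422). [cite: Balaban1983Higgs3, (2.1) p.422] -/
def intScalar (i : ι) : ℕ := (univ.filter fun j : Fin (Γ.kind i).scalarLegs => (Γ.other ⟨i, .inl j⟩).isSome).card

/-- internal A′-legs of a vertex ((2.1) p. 422). [cite: Balaban1983Higgs3, (2.1) p.422] -/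
def intVector (i : ι) : ℕ := (univ.filter fun j : Fin (Γ.kind i).vectorLegs => (Γ.other ⟨i, .inr j⟩).isSome).card

/-- differentiations acting on internal lines ((2.1): the D^η_B̃ of (1.8)/(1.9) acts on the first φ′-leg).
[cite: Balaban1983Higgs3, (2.1) p.422] -/
def intDiffs (i : ι) : ℕ :=
  if h : 0 < (Γ.kind i).scalarLegs then (if (Γ.other ⟨i, .inl ⟨0, h⟩⟩).isSome then (Γ.kind i).diffCount else 0) else 0

omit [Fintype ι] [DecidableEq ι] in
/-- kernel: internal φ′-legs are among the φ′-legs. [cite: Balaban1983Higgs3, (2.1) p.422] -/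
theorem intScalar_le (i : ι) : Γ.intScalar i ≤ (Γ.kind i).scalarLegs := (card_filter_le _ _).trans (by simp)

omit [Fintype ι] [DecidableEq ι] in
/-- kernel: internal A′-legs are among the A′-legs. [cite: Balaban1983Higgs3, (2.1) p.422] -/
theorem intVector_le (i : ι) : Γ.intVector i ≤ (Γ.kind i).vectorLegs := (card_filter_le _ _).trans (by simp)

omit [Fintype ι] [DecidableEq ι] in
/-- kernel: acting differentiations are among the differentiations. [cite: Balaban1983Higgs3, (2.1) p.422] -/
theorem intDiffs_le (i : ι) : Γ.intDiffs i ≤ (Γ.kind i).diffCount := by unfold intDiffs; split_ifs <;> simp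

/-- D_G(v) of (2.1) for the vertex `i`. [cite: Balaban1983Higgs3, (2.1) p.422] -/
def vertexDeg (d : ℕ) (i : ι) : ℚ :=
  degreeIn d (toCounts d (Γ.kind i)) ⟨Γ.intScalar i, Γ.intVector i, Γ.intDiffs i, Γ.intScalar_le i, Γ.intVector_le i, Γ.intDiffs_le i⟩

/-- D(G) of (2.2) (all counterterm degrees 0). [cite: Balaban1983Higgs3, (2.2) p.423] -/
def deg (d : ℕ) : ℚ := (∑ i, Γ.vertexDeg d i) - d

omit [Fintype ι] [DecidableEq ι] in
/-- kernel: (2.1) unfolded. [cite: Balaban1983Higgs3, (2.1) p.422] -/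
theorem vertexDeg_eq (d : ℕ) (i : ι) :
    Γ.vertexDeg d i = ((Γ.kind i).etaCount d : ℚ) + ((Γ.intScalar i + Γ.intVector i : ℕ) : ℚ) * ((2 - (d : ℚ)) / 2)
      - (Γ.intDiffs i : ℚ) + (if (Γ.kind i).isAveragingVertex then (Γ.intVector i : ℚ) else 0) := rfl

end IGraph

variable {nbar : ℕ}

/-- A graph of `B3Cor23Concrete` is an `IGraph` over `Fin nV` (same data). [cite: Balaban1983Higgs3, p.415] -/
def toIGraph (G : Graph nbar) : IGraph nbar (Fin G.nV) :=
  ⟨G.kind, G.adm, G.other, G.other_ne, G.other_symm, G.other_isLeft, G.exists_line⟩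

/-- kernel: the degree (2.2) is the same number on both presentations. [cite: Balaban1983Higgs3, (2.2) p.423] -/
theorem deg_toIGraph (G : Graph nbar) (d : ℕ) : (toIGraph G).deg d = G.deg d := by
  rw [Graph.deg_eq]; rfl

end Literature.MathematicalPhysics.QuantumFieldTheory.Balaban1983to89.B3IGraph
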